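import Literature.NumberTheory.GaloisRepresentations.GlobalPFinitenessProofs
import HarnessLib

/-!
# `M ⊆ K_S ⟺ M/K is unramified outside S` for a finite Galois `M ⊆ K̄`, and the tower step
# (NSW VIII §3; Neukirch VII §10, proof of (10.6): «`𝔭` is ramified ⟺ `I_𝔓 ≠ 1`»)

Topic `NumberTheory/GaloisRepresentations`; namespace `Literature.NumberTheory.GaloisRepresentations`.  THEOREMS ONLY (no
definition, no named fact, no `sorry`, no instance).  The dictionary between the tree's group-theoretic `K_S` — the
ramification subgroup `N_S = ramificationSubgroup K S ≤ Γ_K` (closed normal subgroup generated by the inertia groups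
above the places outside `S`; `G_{K,S} = Γ_K ⧸ N_S`, `RestrictedRamification.lean`) — and ramification in a finite Galois
subfield `M ⊆ K̄ = AlgebraicClosure K`:

* `ramificationSubgroup_le_fixingSubgroup_of_forall_isUnramifiedIn` — if `M/K` is unramified at every finite place
  `v ∉ S` then `N_S ≤ Gal(K̄/M)` («`M ⊆ K_S`»): the inertia groups above `v ∉ S` die in `Gal(M/K)`
  (`absRestrictNormalHom_eq_one_of_isUnramifiedIn`) and the universal property `ramificationSubgroup_le_ker`;
* the converse is the tree's `isUnramifiedIn_of_ramificationSubgroup_le_fixingSubgroup` (`GlobalPFinitenessProofs.lean`: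
  `N_S ≤ Gal(K̄/M)` forces `M/K` unramified at every `v ∉ S`); together `ramificationSubgroup_le_fixingSubgroup_iff`;
* `isUnramifiedIn_of_isUnramifiedIn_tower` — TOWER STEP for number fields `K ⊆ E ⊆ M` (abstract types in a scalar
  tower): `E/K` unramified at `v` and `M/E` unramified at every place of `E` above `v` ⟹ `M/K` unramified at `v`
  (`e` is multiplicative, Mathlib `Ideal.ramificationIdx_tower`; the pattern of `HilbertClassFieldTower.isUnramifiedIn_H2`);
* `ramificationSubgroup_le_fixingSubgroup_of_tower` — hence: `E ⊆ M ⊆ K̄` finite Galois over `K`, `N_S ≤ Gal(K̄/E)`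
  (`E ⊆ K_S`) and `M/E` unramified at every finite place of `E` ⟹ `N_S ≤ Gal(K̄/M)` (`M ⊆ K_S`) — the placement of an
  everywhere-unramified extension (e.g. the Hilbert class field) of a layer of `K_S` inside `K_S`.

Brick (A3c-2) of lane «PT3-TC» of cell `bsd-eis` (crux 2 `GoodLatticeBDPValue`, stmt-BirchSwinnertonDyer-19032; lane owner
bsd-line-x1-p1-w8 g9, road memo `PT3TC-ROAD.md`; this brick by width seat -w6 g8).  HONEST FRAMING: dictionary lemmas; no
statement of any Summit is proved; BSD is not advanced by this file.

## References
* J. Neukirch, A. Schmidt, K. Wingberg, *Cohomology of Number Fields*, 2nd ed. (2008), VIII §3 (`k_S`, `G_S`).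
  [NeukirchSchmidtWingberg2008]
* J. Neukirch, *Algebraic Number Theory* (1999), Ch. VII §10, proof of Thm. (10.6); Ch. II §9 (`e` in towers).
  [NeukirchANT1999]
* D. Harari, *Galois Cohomology and Class Field Theory* (2020), Def. 15.36 (`k_S`). [Harari2020]
-/

noncomputable section

open NumberField IsDedekindDomain Field

namespace Literature.NumberTheory.GaloisRepresentations

universe u

variable {K : Type u} [Field K] [NumberField K] {S : Set (HeightOneSpectrum (𝓞 K))}

/-! ## §1. `M ⊆ K_S ⟺ M/K unramified outside S` -/

omit [NumberField K] in
/-- `σ|_M = 1` iff `σ ∈ Gal(K̄/M)` (infinite Galois theory: the kernel of the restriction `Gal(K̄/K) → Gal(M/K)` is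
`Gal(K̄/M)`; Mathlib `IntermediateField.restrictNormalHom_ker`). [cite: NeukirchANT1999, Ch. IV §1 Thm. (1.1)] -/
theorem absRestrictNormalHom_eq_one_iff_mem_fixingSubgroup (M : IntermediateField K (AlgebraicClosure K))
    [Normal K M] (σ : absoluteGaloisGroup K) :
    absRestrictNormalHom M σ = 1 ↔ σ ∈ (M.fixingSubgroup : Subgroup (absoluteGaloisGroup K)) := by
  change AlgEquiv.restrictNormalHom M (absoluteGaloisGroup.toAlgEquiv K σ) = 1 ↔
    absoluteGaloisGroup.toAlgEquiv K σ ∈ M.fixingSubgroup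
  rw [← MonoidHom.mem_ker, IntermediateField.restrictNormalHom_ker]

omit [NumberField K] in
/-- The kernel of `σ ↦ σ|_M` on `Γ_K` is `Gal(K̄/M)` (infinite Galois theory). [cite: NeukirchANT1999, Ch. IV §1 Thm. (1.1)] -/
theorem ker_absRestrictNormalHom_eq_fixingSubgroup (M : IntermediateField K (AlgebraicClosure K)) [Normal K M] :
    (absRestrictNormalHom M).ker = M.fixingSubgroup := by
  ext σ
  rw [MonoidHom.mem_ker, absRestrictNormalHom_eq_one_iff_mem_fixingSubgroup]
  exact Iff.rfl

/-- **`M/K` unramified outside `S` ⟹ `M ⊆ K_S`**: for a finite Galois `M ⊆ K̄` unramified at every finite place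
`v ∉ S`, the ramification subgroup `N_S` fixes `M` — the inertia groups above `v ∉ S` die in `Gal(M/K)` and `N_S` is
the closed normal subgroup they generate. [cite: NeukirchSchmidtWingberg2008, VIII §3]
[cite: NeukirchANT1999, Ch. VII §10 Thm. (10.6) (proof)] -/
theorem ramificationSubgroup_le_fixingSubgroup_of_forall_isUnramifiedIn
    (M : IntermediateField K (AlgebraicClosure K)) [FiniteDimensional K M] [IsGalois K M]
    (h : ∀ v : HeightOneSpectrum (𝓞 K), v ∉ S → Algebra.IsUnramifiedIn (𝓞 M) v.asIdeal) :
    ramificationSubgroup K S ≤ M.fixingSubgroup := by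
  haveI : NumberField M := NumberField.of_module_finite K M
  rw [← ker_absRestrictNormalHom_eq_fixingSubgroup]
  refine ramificationSubgroup_le_ker (absRestrictNormalHom M) ?_ fun v hv 𝔓 h𝔓 σ hσ ↦
    absRestrictNormalHom_eq_one_of_isUnramifiedIn M (h v hv) h𝔓 hσ
  rw [ker_absRestrictNormalHom_eq_fixingSubgroup]
  exact M.fixingSubgroup_isOpen

/-- **`M ⊆ K_S ⟺ M/K` unramified outside `S`** (finite Galois `M ⊆ K̄`). [cite: NeukirchSchmidtWingberg2008, VIII §3]
[cite: Harari2020, Def. 15.36] -/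
theorem ramificationSubgroup_le_fixingSubgroup_iff
    (M : IntermediateField K (AlgebraicClosure K)) [FiniteDimensional K M] [IsGalois K M] :
    ramificationSubgroup K S ≤ M.fixingSubgroup ↔
      ∀ v : HeightOneSpectrum (𝓞 K), v ∉ S → Algebra.IsUnramifiedIn (𝓞 M) v.asIdeal := by
  haveI : NumberField M := NumberField.of_module_finite K M
  exact ⟨fun h _ hv ↦ isUnramifiedIn_of_ramificationSubgroup_le_fixingSubgroup M h hv,
    ramificationSubgroup_le_fixingSubgroup_of_forall_isUnramifiedIn M⟩

/-! ## §2. The tower step -/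

/-- **`e` is multiplicative: `E/K` unramified at `v` and `M/E` unramified above `v` ⟹ `M/K` unramified at `v`** — for
number fields `K ⊆ E ⊆ M` in a scalar tower and a finite place `v` of `K`: if `v` is unramified in `E` and every place
`w` of `E` above `v` is unramified in `M`, then `v` is unramified in `M` (`e(Q|v) = e(Q ∩ 𝓞_E|v) · e(Q|Q ∩ 𝓞_E) = 1`).
[cite: NeukirchANT1999, Ch. II §9 (multiplicativity of `e` in towers)] -/
theorem isUnramifiedIn_of_isUnramifiedIn_tower (E M : Type*) [Field E] [NumberField E] [Field M] [NumberField M]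
    [Algebra K E] [Algebra E M] [Algebra K M] [IsScalarTower K E M]
    (v : HeightOneSpectrum (𝓞 K)) (hE : Algebra.IsUnramifiedIn (𝓞 E) v.asIdeal)
    (hM : ∀ w : HeightOneSpectrum (𝓞 E), w.asIdeal.LiesOver v.asIdeal → Algebra.IsUnramifiedIn (𝓞 M) w.asIdeal) :
    Algebra.IsUnramifiedIn (𝓞 M) v.asIdeal := by
  -- adapted from the tree's `HilbertClassFieldTower.isUnramifiedIn_H2` (hodge lane)
  haveI : IsScalarTower (𝓞 K) (𝓞 E) (𝓞 M) := IsScalarTower.of_algebraMap_eq fun x =>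
    Subtype.ext (IsScalarTower.algebraMap_apply K E M (x : K))
  intro Q hQ hQv
  haveI := hQ
  have hQ0 : Q ≠ ⊥ := by
    intro h0
    apply v.ne_bot
    rw [hQv.over, h0, Ideal.under_def, Ideal.comap_bot_of_injective _
      (FaithfulSMul.algebraMap_injective (𝓞 K) (𝓞 M))]
  haveI : Q.IsMaximal := hQ.isMaximal hQ0
  set P := Q.under (𝓞 E) with hP
  have hP0 : P ≠ ⊥ := by
    intro h0
    apply v.ne_bot
    have : v.asIdeal = P.under (𝓞 K) := by
      rw [hQv.over, hP, Ideal.under_under]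
    rw [this, h0, Ideal.under_def, Ideal.comap_bot_of_injective _
      (FaithfulSMul.algebraMap_injective (𝓞 K) (𝓞 E))]
  haveI : P.IsMaximal := Ideal.IsMaximal.under (𝓞 E) Q
  let w : HeightOneSpectrum (𝓞 E) := ⟨P, inferInstance, hP0⟩
  haveI hPv : P.LiesOver v.asIdeal := ⟨by rw [hP, Ideal.under_under]; exact hQv.over⟩
  haveI : Algebra.IsUnramifiedAt (𝓞 K) P := hE P inferInstance inferInstance
  haveI : Algebra.IsUnramifiedAt (𝓞 E) Q := hM w hPv Q hQ ⟨rfl⟩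
  have htower : Q.ramificationIdx (𝓞 K) = P.ramificationIdx (𝓞 K) * Q.ramificationIdx (𝓞 E) :=
    Ideal.ramificationIdx_tower P Q
  rw [Ideal.ramificationIdx_eq_one P (𝓞 K), Ideal.ramificationIdx_eq_one Q (𝓞 E), one_mul] at htower
  exact (Ideal.ramificationIdx_eq_one_iff).mp htower

/-- **Placement of an everywhere-unramified extension of a layer of `K_S` inside `K_S`.** For finite Galois subfields
`E ≤ M` of `K̄/K` (with the algebra structure `E → M` of the inclusion, or any compatible one): if `N_S` fixes `E`
(«`E ⊆ K_S`») and `M/E` is unramified at every finite place of `E`, then `N_S` fixes `M` («`M ⊆ K_S`») — e.g. the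
Hilbert class field of a layer of `K_S` is again inside `K_S`. [cite: NeukirchSchmidtWingberg2008, VIII §3 (proof of (8.3.11): the Hilbert class field tower lies in k_S)]
[cite: NeukirchANT1999, Ch. II §9] -/
theorem ramificationSubgroup_le_fixingSubgroup_of_tower (E M : IntermediateField K (AlgebraicClosure K))
    [FiniteDimensional K E] [IsGalois K E] [FiniteDimensional K M] [IsGalois K M]
    [Algebra E M] [IsScalarTower K E M]
    (hE : ramificationSubgroup K S ≤ E.fixingSubgroup)
    (hM : ∀ w : HeightOneSpectrum (𝓞 E), Algebra.IsUnramifiedIn (𝓞 M) w.asIdeal) :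
    ramificationSubgroup K S ≤ M.fixingSubgroup := by
  haveI : NumberField E := NumberField.of_module_finite K E
  haveI : NumberField M := NumberField.of_module_finite K M
  refine ramificationSubgroup_le_fixingSubgroup_of_forall_isUnramifiedIn M fun v hv ↦ ?_
  exact isUnramifiedIn_of_isUnramifiedIn_tower (K := K) E M v
    (isUnramifiedIn_of_ramificationSubgroup_le_fixingSubgroup E hE hv) fun w _ ↦ hM w

end Literature.NumberTheory.GaloisRepresentations

end
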